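import Summits.ABC.ABC.Theses.IUTThetaPilot
import Summits.ABC.ABC.Theorems.IUTThetaPilotJInvWlog
import Literature.IUT.LogVolume.Corollary22PartII
import Literature.IUT.LogVolume.Corollary22GaloisImage
import HarnessLib

set_option linter.dupNamespace false

/-!
# Route `route-ABC-IUTThetaPilot`: the crux `ThetaPartII` (stmt-ABC-19678) CONDITIONAL on the single
# named interface `Cor22.Thm110Legendre`, and the summit `ABC` from `Thm110Legendre` and `GenEllTwo`

The crux `ThetaPartII` of the route ([IUTchIV] Cor. 2.2 (ii), uniform: `∃ H_II, ∀ K_V, Cor22.Hypotheses K_V →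
Cor22.PartII K_V H_II`) is here derived from the ONE named hypothesis
`Literature.IUT.LogVolume.Cor22.Thm110Legendre` — what the printed proof of Cor. 2.2 (ii) takes from
[IUTchIV] Theorem 1.10 (first display, p. 46 l. 1, including the existence of the initial Θ-data (P7));
Theorem 1.10 rests on [IUTchIII] Cor. 3.12 (DISPUTED — the hypothesis is never asserted). Everything else in
the printed proof (pp. 43–48) is PROVED in the tree (campaign S): the exceptional sets and the prime `l`
((P1)–(P3), `Cor22.partII_of_thm110Legendre`, abc-iut-S3), the classical Galois-image input (P4) ⇒ (P6)
([GenEll] Lem. 3.5, Prop. 3.4, Lem. 3.1 (iii), Tate transvection: `Cor22.fullGaloisImage_holds`, abc-iut-S-d2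
over abc-iut-S-d4 / S5 / S-d1), parts (i) and (iii) of Cor. 2.2.  S. Mochizuki, *Inter-universal Teichmüller
theory IV*, Cor. 2.2, pp. 41–48.  CONDITIONAL RESULT (the gate records `proof.conditional`): the crux item
stays OPEN; this file shows exactly what it now hinges on. HONEST FRAMING: nothing here asserts abc or takes a
side on [IUTchIII] Cor. 3.12; `ABC_of_thm110Legendre_of_genEllTwo` says `ABC` follows from the two named open
inputs `Thm110Legendre` (disputed chain) and `GenEllTwo` ([GenEll] Thm 2.1 at `Σ = {2}`, formalisation debt).
-/

namespace Summit.ABC.ABC.Theorems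

/-- **The crux `ThetaPartII` from `Thm110Legendre` alone** ([IUTchIV] Cor. 2.2 (ii), proof pp. 43–48, with
(P4) ⇒ (P6) discharged): `Cor22.Thm110Legendre → ThetaPartII`, by abc-iut-S3's
`Cor22.exists_partII_of_thm110Legendre` and the landed `Cor22.fullGaloisImage_holds`. Conditional on the named
interface `Thm110Legendre` (disputed chain); does not close the item.
[cite: Mochizuki2012, IUTchIV Cor. 2.2 (ii) pp.41–48] -/
theorem ThetaPartII_of_thm110Legendre (hH : Literature.IUT.LogVolume.Cor22.Thm110Legendre) :
    Summit.ABC.ABC.Theses.IUTThetaPilot.ThetaPartII := by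
  unfold Summit.ABC.ABC.Theses.IUTThetaPilot.ThetaPartII
  exact Literature.IUT.LogVolume.Cor22.exists_partII_of_thm110Legendre hH
    Literature.IUT.LogVolume.Cor22.fullGaloisImage_holds

/-- **`ABC` from the two named open inputs of the route** — `Thm110Legendre` (what Cor. 2.2 (ii) takes from
[IUTchIV] Thm. 1.10; disputed chain) and `GenEllTwo` ([GenEll] Thm. 2.1, (ii) ⟹ (i) at `Σ = {2}`;
formalisation debt) — through the route's deciding theorem `closes` with `ThetaPartII_of_thm110Legendre` and
the proved support `JInvWlog_proof`. Nothing is asserted unconditionally.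
[cite: Mochizuki2012, IUTchIV Cor. 2.2–2.3 pp.41–55] -/
theorem ABC_of_thm110Legendre_of_genEllTwo (hH : Literature.IUT.LogVolume.Cor22.Thm110Legendre)
    (hG : Summit.ABC.ABC.Theses.IUTThetaPilot.GenEllTwo) : _root_.ABC :=
  Summit.ABC.ABC.Theses.IUTThetaPilot.closes (ThetaPartII_of_thm110Legendre hH) hG JInvWlog_proof

end Summit.ABC.ABC.Theorems
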